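import Mathlib
import Summits.Ventures.PercRepro.TriangleCapRegularCell

/-!
# PercRepro — THE REGULAR BOUND IS TIGHT: THE `D`-REGULAR CIRCULANT ON `m + m` VERTICES, `D ≤ m ≤ ℓ`
(p3, gen 54; part 296)

The regular bound of part 279, `t (t − 1) ≤ 2 j + 2 t (D − 1)` for every off-degree `≤ D`, is attained exactly by
the `D`-regular off-edge graphs without inside edges.  When `t = m D` with `D ≤ m ≤ ℓ` such a graph exists inside
the non-neighbourhood: THE CIRCULANT — `m` non-neighbours `1, …, m` and `m` leaves `ℓ + 1, …, ℓ + m`, the pair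
`i < m D` joining the non-neighbour `1 + ⌊i/D⌋` to the leaf `ℓ + 1 + ((⌊i/D⌋ + i mod D) mod m)`: every
non-neighbour carries the `D` pairs of its block, every leaf the `D` pairs `(a, j)` with `a + j ≡ b (mod m)`
(one per `j < D`).  `coll lf = coll rf = m D (D − 1)` and the band value is `2 j = t (t − 1) − 2 t (D − 1)`.
THEOREM (`regular_bound_tight`, `1 ≤ D ≤ m ≤ ℓ`, `t = m D`, `2 t ≤ s`): the bottom of the sub-band `u = t − D` on
`ℓ + 1 + (s − t)` vertices is exactly `C(t,2) − t (D − 1)` — the bound for every graph, the circulant the witness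
(with every off-degree `≤ D` and a non-neighbour of off-degree `D`).  With part 287 (`ℓ ≤ D`: the bottom is
`K_{ℓ,D}`, above the regular bound by `ℓ D (D − ℓ)/2`) the bottom of the cell `t = m D` is known for every `m ≤ ℓ`.
Axioms: standard.
-/

namespace PercRepro

namespace TriangleCap

namespace C047

open Finset

/-- The left ends of the circulant: the non-neighbour `1 + ⌊i/D⌋`. -/
def lfCirc (D i : ℕ) : ℕ := 1 + i / D

/-- The right ends of the circulant: the leaf `ℓ + 1 + ((⌊i/D⌋ + i mod D) mod m)`. -/
def rfCirc (ℓ m D i : ℕ) : ℕ := ℓ + 1 + (i / D + i % D) % m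

/-- The class of the non-neighbour `1 + a` (`a < m`): the `D` pairs of its block. -/
theorem cls_lfCirc (m D a : ℕ) (hD : 0 < D) (ha : a < m) :
    ((range (m * D)).filter (fun i => lfCirc D i = 1 + a)).card = D := by
  have h := cls_rfBlock D m a hD ha
  have e : (range (D * m)).filter (fun i => rfBlock D i = D + 1 + a) =
      (range (m * D)).filter (fun i => lfCirc D i = 1 + a) := by
    rw [mul_comm D m]
    apply filter_congr
    intro i _
    unfold rfBlock lfCirc
    omega
  rw [← e, h]

/-- The index of the pair `(a, j)`: `a D + j`. -/
theorem div_mod_of_lt (D a j : ℕ) (hD : 0 < D) (hj : j < D) : (a * D + j) / D = a ∧ (a * D + j) % D = j := by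
  constructor
  · rw [Nat.add_comm, Nat.add_mul_div_right _ _ hD, Nat.div_eq_of_lt hj, zero_add]
  · rw [Nat.add_comm, Nat.add_mul_mod_self_right, Nat.mod_eq_of_lt hj]

/-- Every index `i < m D` is a pair `(a, j)`: `i = a D + j`, `a < m`, `j < D`. -/
theorem index_split (D m i : ℕ) (hD : 0 < D) (hi : i < m * D) :
    ∃ a j, a < m ∧ j < D ∧ i = a * D + j ∧ i / D = a ∧ i % D = j := by
  refine ⟨i / D, i % D, ?_, Nat.mod_lt i hD, ?_, rfl, rfl⟩
  · rw [Nat.div_lt_iff_lt_mul hD]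
    exact hi
  · have h := Nat.div_add_mod i D
    rw [mul_comm] at h
    exact h.symm

/-- A number below `2 m` reduced mod `m`. -/
theorem mod_two_cases (m x : ℕ) (_hm : 0 < m) (hx : x < 2 * m) :
    (x < m ∧ x % m = x) ∨ (m ≤ x ∧ x % m = x - m) := by
  rcases Nat.lt_or_ge x m with h | h
  · exact Or.inl ⟨h, Nat.mod_eq_of_lt h⟩
  · refine Or.inr ⟨h, ?_⟩
    rw [Nat.mod_eq_sub_mod h, Nat.mod_eq_of_lt (by omega)]

/-- The class of the leaf `ℓ + 1 + b` (`b < m`, `D ≤ m`): the `D` pairs `(a, j)` with `a + j ≡ b (mod m)`. -/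
theorem cls_rfCirc (ℓ m D b : ℕ) (hD : 0 < D) (hDm : D ≤ m) (hb : b < m) :
    ((range (m * D)).filter (fun i => rfCirc ℓ m D i = ℓ + 1 + b)).card = D := by
  have hm : 0 < m := by omega
  -- the pairs of the class are the images of `j < D` under `j ↦ ((b + m − j) % m) D + j`
  have hset : (range (m * D)).filter (fun i => rfCirc ℓ m D i = ℓ + 1 + b) =
      (range D).image (fun j => ((b + m - j) % m) * D + j) := by
    ext i
    simp only [mem_filter, mem_range, mem_image]
    unfold rfCirc
    constructor
    · rintro ⟨hi, hv⟩
      obtain ⟨a, j, ha, hj, hij, hia, hib⟩ := index_split D m i hD hi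
      rw [hia, hib] at hv
      have hmod : (a + j) % m = b := by omega
      refine ⟨j, hj, ?_⟩
      rcases mod_two_cases m (a + j) hm (by omega) with ⟨h1, h2⟩ | ⟨h1, h2⟩
      · have : b + m - j = a + m := by omega
        rw [this, Nat.add_mod_right, Nat.mod_eq_of_lt ha]
        omega
      · have : b + m - j = a := by omega
        rw [this, Nat.mod_eq_of_lt ha]
        omega
    · rintro ⟨j, hj, rfl⟩
      have ha : (b + m - j) % m < m := Nat.mod_lt _ hm
      obtain ⟨h1, h2⟩ := div_mod_of_lt D ((b + m - j) % m) j hD hj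
      refine ⟨?_, ?_⟩
      · have : ((b + m - j) % m + 1) * D ≤ m * D := Nat.mul_le_mul_right D (by omega)
        rw [Nat.succ_mul] at this
        omega
      · rw [h1, h2, Nat.mod_add_mod]
        have : b + m - j + j = b + m := by omega
        rw [this, Nat.add_mod_right, Nat.mod_eq_of_lt hb]
  rw [hset, card_image_of_injOn, card_range]
  intro j hj j' hj' h
  rw [mem_coe, mem_range] at hj hj'
  have e1 := div_mod_of_lt D ((b + m - j) % m) j hD hj
  have e2 := div_mod_of_lt D ((b + m - j') % m) j' hD hj'
  simp only at h
  rw [h] at e1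
  omega

/-- The bounds of `rfCirc`: `ℓ + 1 ≤ rfCirc i < ℓ + 1 + m`. -/
theorem rfCirc_bounds (ℓ m D i : ℕ) (hm : 0 < m) : ℓ + 1 ≤ rfCirc ℓ m D i ∧ rfCirc ℓ m D i < ℓ + 1 + m := by
  unfold rfCirc
  have := Nat.mod_lt (i / D + i % D) hm
  obtain ⟨r, hr⟩ : ∃ r, (i / D + i % D) % m = r := ⟨_, rfl⟩
  rw [hr] at this ⊢
  omega

/-- The bounds of `lfCirc`: `1 ≤ lfCirc i ≤ m` for `i < m D`. -/
theorem lfCirc_bounds (m D i : ℕ) (hD : 0 < D) (hi : i < m * D) : 1 ≤ lfCirc D i ∧ lfCirc D i ≤ m := by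
  unfold lfCirc
  obtain ⟨a, j, ha, hj, hij, hia, hib⟩ := index_split D m i hD hi
  rw [hia]
  omega

/-- The ends of the circulant are good (`1 ≤ D ≤ m ≤ ℓ`, `2 m D ≤ s`). -/
theorem goodEnds_circ (s ℓ m D : ℕ) (hD : 1 ≤ D) (hDm : D ≤ m) (hmℓ : m ≤ ℓ) (hs : 2 * (m * D) ≤ s) :
    GoodEnds (ℓ + 1 + (s - m * D)) (ℓ + 1) (m * D) (lfCirc D) (rfCirc ℓ m D) := by
  have hm : 0 < m := by omega
  refine ⟨fun i hi => ?_, fun i _ => ?_, fun i i' hi hi' h1 h2 => ?_⟩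
  · have := lfCirc_bounds m D i (by omega) hi
    omega
  · have := rfCirc_bounds ℓ m D i hm
    have hDs : m ≤ s - m * D := by
      have : m ≤ m * D := Nat.le_mul_of_pos_right m hD
      omega
    omega
  · unfold lfCirc at h1
    unfold rfCirc at h2
    obtain ⟨a, j, ha, hj, hij, hia, hib⟩ := index_split D m i (by omega) hi
    obtain ⟨a', j', ha', hj', hij', hia', hib'⟩ := index_split D m i' (by omega) hi'
    rw [hia, hib] at h2
    rw [hia', hib'] at h2
    rw [hia, hia'] at h1
    have haa : a = a' := by omega
    subst haa
    -- `j, j' < D ≤ m` with the same class mod `m`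
    have hjj : j = j' := by
      rcases mod_two_cases m (a + j) hm (by omega) with ⟨h3, h4⟩ | ⟨h3, h4⟩ <;>
        rcases mod_two_cases m (a + j') hm (by omega) with ⟨h5, h6⟩ | ⟨h5, h6⟩ <;> omega
    subst hjj
    omega

/-- `coll (m D) lfCirc = m D (D − 1)`. -/
theorem coll_lfCirc (m D : ℕ) (hD : 0 < D) : coll (m * D) (lfCirc D) = m * (D * (D - 1)) := by
  rw [coll_eq_sum_cls (m * D) (lfCirc D) ((range m).image (fun a => 1 + a)) (fun i hi => by
    rw [mem_image]
    have := lfCirc_bounds m D i hD hi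
    exact ⟨lfCirc D i - 1, mem_range.mpr (by omega), by omega⟩)]
  rw [sum_image (fun a _ a' _ h => by omega)]
  rw [sum_const_nat (m := D * (D - 1)) (fun a ha => by
    unfold cls
    rw [cls_lfCirc m D a hD (mem_range.mp ha)]), card_range]

/-- `coll (m D) rfCirc = m D (D − 1)` (`D ≤ m`). -/
theorem coll_rfCirc (ℓ m D : ℕ) (hD : 0 < D) (hDm : D ≤ m) :
    coll (m * D) (rfCirc ℓ m D) = m * (D * (D - 1)) := by
  have hm : 0 < m := by omega
  rw [coll_eq_sum_cls (m * D) (rfCirc ℓ m D) ((range m).image (fun b => ℓ + 1 + b)) (fun i _ => by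
    rw [mem_image]
    have := rfCirc_bounds ℓ m D i hm
    exact ⟨rfCirc ℓ m D i - (ℓ + 1), mem_range.mpr (by omega), by omega⟩)]
  rw [sum_image (fun b _ b' _ h => by omega)]
  rw [sum_const_nat (m := D * (D - 1)) (fun b hb => by
    unfold cls
    rw [cls_rfCirc ℓ m D b hD hDm (mem_range.mp hb)]), card_range]

/-- **THE CIRCULANT WITNESS:** for `1 ≤ D ≤ m ≤ ℓ`, `t = m D`, `2 t ≤ s`, a triangle-free graph on `ℓ + 1 + (s − t)`
vertices with `s` edges, a vertex `w` of degree `s − t`, every off-degree `≤ D`, a non-neighbour of off-degree `D`,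
and the band value `2 j = t (t − 1) − 2 t (D − 1)`. -/
theorem circWitness (s ℓ m D : ℕ) (hD : 1 ≤ D) (hDm : D ≤ m) (hmℓ : m ≤ ℓ) (hs : 2 * (m * D) ≤ s) :
    ∃ (H : SimpleGraph (Fin (ℓ + 1 + (s - m * D)))) (_ : DecidableRel H.Adj), H.CliqueFree 3 ∧
      H.edgeFinset.card = s ∧ ∃ w, deg H w + m * D = s ∧ (∀ v, offDeg H w v ≤ D) ∧
        (∃ x, ¬ H.Adj w x ∧ offDeg H w x = D) ∧
        ∑ v, deg H v * deg H v + 2 * (m * D * (s - m * D - 1)) +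
          (m * D * (m * D - 1) - 2 * (m * D * (D - 1))) = s * (s + 1) := by
  set n := ℓ + 1 + (s - m * D) with hn
  have hn0 : 0 < n := by omega
  have hm : 0 < m := by omega
  have ht0 : 0 < m * D := Nat.mul_pos hm (by omega)
  have hg := goodEnds_circ s ℓ m D hD hDm hmℓ hs
  have hval := genWitness_missing_value n (ℓ + 1) s (m * D) hn0 (lfCirc D) (rfCirc ℓ m D) hg (by omega)
    (by omega) (by omega) (by omega)
  have hatt : ((range (m * D)).filter (fun i => rfCirc ℓ m D i < ℓ + 1 + (s - m * D))).card = m * D := by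
    rw [filter_true_of_mem (fun i _ => by
      have := rfCirc_bounds ℓ m D i hm
      have hDs : m ≤ s - m * D := by
        have : m ≤ m * D := Nat.le_mul_of_pos_right m hD
        omega
      omega), card_range]
  rw [hatt, coll_lfCirc m D (by omega), coll_rfCirc ℓ m D (by omega) hDm, Nat.sub_self, mul_zero, zero_add]
    at hval
  have hcl : m * (D * (D - 1)) + m * (D * (D - 1)) = 2 * (m * D * (D - 1)) := by ring
  rw [hcl] at hval
  refine ⟨_, inferInstance, cliqueFree_of_bipSub _ _ (bipSub_missingGraph _ _),
    card_edges_missingGraph_genWitness n (ℓ + 1) s (m * D) hn0 (lfCirc D) (rfCirc ℓ m D) hg (by omega)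
      (by omega) (by omega), fin' n hn0 0, ?_, ?_, ?_, hval⟩
  · rw [deg_missingGraph_genWitness_zero n (ℓ + 1) s (m * D) hn0 (lfCirc D) (rfCirc ℓ m D) hg (by omega)
      (by omega)]
    omega
  · intro v
    have hv : v = fin' n hn0 v.val := Fin.ext (by rw [fin'_val n hn0 v.val v.isLt])
    rw [hv]
    by_cases hva : v.val < ℓ + 1
    · rw [offDeg_genWitness_left n (ℓ + 1) s (m * D) hn0 (lfCirc D) (rfCirc ℓ m D) hg (by omega) v.val hva]
      by_cases hvm : 1 ≤ v.val ∧ v.val ≤ m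
      · obtain ⟨a, ha⟩ : ∃ a, v.val = 1 + a := ⟨v.val - 1, by omega⟩
        rw [ha, cls_lfCirc m D a (by omega) (by omega)]
      · rw [card_eq_zero.mpr (filter_eq_empty_iff.mpr (fun i hi hv' => by
          rw [mem_range] at hi
          have := lfCirc_bounds m D i (by omega) hi
          omega))]
        omega
    · rw [offDeg_genWitness_right n (ℓ + 1) s (m * D) hn0 (lfCirc D) (rfCirc ℓ m D) hg (by omega) v.val
        (by omega) v.isLt]
      by_cases hvb : v.val < ℓ + 1 + m
      · obtain ⟨b, hb⟩ : ∃ b, v.val = ℓ + 1 + b := ⟨v.val - (ℓ + 1), by omega⟩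
        rw [hb, cls_rfCirc ℓ m D b (by omega) hDm (by omega)]
      · rw [card_eq_zero.mpr (filter_eq_empty_iff.mpr (fun i _ hv' => by
          have := rfCirc_bounds ℓ m D i hm
          omega))]
        omega
  · refine ⟨fin' n hn0 1, not_adj_genWitness_one n (ℓ + 1) s (m * D) hn0 (lfCirc D) (rfCirc ℓ m D) (by omega)
      (by omega), ?_⟩
    rw [offDeg_genWitness_left n (ℓ + 1) s (m * D) hn0 (lfCirc D) (rfCirc ℓ m D) hg (by omega) 1 (by omega)]
    have := cls_lfCirc m D 0 (by omega) hm
    rw [add_zero] at this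
    exact this

/-- **THE REGULAR BOUND IS TIGHT ON THE CELL `t = m D`, `D ≤ m ≤ ℓ`:** every graph on `ℓ + 1 + (s − t)` vertices
with a vertex of degree `s − t` and every off-degree `≤ D` has `t (t − 1) ≤ 2 j + 2 t (D − 1)`, and the circulant
attains `2 j + 2 t (D − 1) = t (t − 1)` with maximum off-degree exactly `D`. -/
theorem regular_bound_tight (s t ℓ m D : ℕ) (hD : 1 ≤ D) (hDm : D ≤ m) (hmℓ : m ≤ ℓ) (ht : t = m * D)
    (hs : 2 * t ≤ s) :
    (∀ (H : SimpleGraph (Fin (ℓ + 1 + (s - t)))) [DecidableRel H.Adj], H.CliqueFree 3 →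
      H.edgeFinset.card = s → ∀ w, deg H w + t = s → (∀ v, offDeg H w v ≤ D) →
      ∀ j, ∑ v, deg H v * deg H v + 2 * (t * (s - t - 1)) + 2 * j = s * (s + 1) →
      t * (t - 1) ≤ 2 * j + 2 * (t * (D - 1))) ∧
    (∃ (H : SimpleGraph (Fin (ℓ + 1 + (s - t)))) (_ : DecidableRel H.Adj), H.CliqueFree 3 ∧
      H.edgeFinset.card = s ∧ ∃ w, deg H w + t = s ∧ (∀ v, offDeg H w v ≤ D) ∧
        (∃ x, ¬ H.Adj w x ∧ offDeg H w x = D) ∧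
        ∑ v, deg H v * deg H v + 2 * (t * (s - t - 1)) + (t * (t - 1) - 2 * (t * (D - 1))) = s * (s + 1)) := by
  subst ht
  refine ⟨fun H _ hfree hsH w hw hD' j hj => ?_, ?_⟩
  · have hw1 : 1 ≤ deg H w := by
      have : 0 < m * D := Nat.mul_pos (by omega) (by omega)
      omega
    exact band_ge_regular H hfree s (m * D) j D hsH w hw hw1 hj hD'
  · exact circWitness s ℓ m D hD hDm hmℓ hs

end C047

end TriangleCap

end PercRepro
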